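import Summits.HodgeConjecture.HodgeConjecture.Theorems.Ring2HypothesesWeilComponentsCMRosatiHolds
import Literature.AlgebraicGeometry.Deligne1982.WeilTypeCMRosatiPolarization
import HarnessLib

/-!
# Ring 2 — hypotheses layer, part XXXI-C: node 31a `RosatiKaehlerClassSupplyCM` HOLDS (van Geemen 5.2 (1) / Deligne Thm. 4.8 (a)
  for every CM field, a Literature THEOREM); node 31 `PolarizedWeilDiscriminantCMExists` HOLDS; the δ-exactness rows and
  rows W1-CM-Σ / W1′-CM-Σ / anchored-Σ / `HC_CM ⟺ R∞ ∧ R3` lose their supply binder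

HONEST FRAMING: research route conditional on HC_CM; not a corollary; Q11.4-sentence-2 already refuted in dim ≥ 3.

Cell `pub-hodge-ring2`, seat `pub-hodge-ring2-typer2`, gen 22. Bookkeeping only: no new hypothesis node, no new class
target, no `def`; nothing here is a case of the Hodge conjecture, and `HC_CM` (`Theses.RankFourFaces.CMAbelianHodge`)
occurs only as an ARGUMENT of row W1-CM-Σ and as the statement priced by the `iff` row, never as a fact.

WHAT HAPPENED. Part XXXI (`Ring2HypothesesWeilComponentsCMRosati`) split node 31 of part VII-C into 31a
`RosatiKaehlerClassSupplyCM` (N70: every Weil-type CM datum `(A, η; R, e₀, k)` carries a rational algebraic class of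
Kähler type `h` with `Q_h(η^*x, y) = -Q_h(x, η^*y)` — the sentence Deligne ASSUMES, Thm. 4.8 (a), p. 47) and 31b
`PolarizedWeilDiscriminantCMExistsR` (N71: Deligne's discriminant witness for every such class); part XXXI-B discharged 31b
over the Literature theorem `Deligne1982.exists_hasWeilDiscriminantCM` and reduced node 31 to 31a alone
(`polarizedWeilDiscriminantCMExists_of_supply`). The Literature seat has now PROVED 31a's body on the carriers for a CM
field of ANY degree: `Deligne1982.exists_rosatiCompatible_kaehlerClass`
(`Literature/AlgebraicGeometry/Deligne1982/WeilTypeCMRosatiPolarization.lean`) — van Geemen's Lemma 5.2 (1) averaging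
argument, written with the `E ⊗ E`-idempotent in orthogonal-basis form: `h = Σ_j q_j u_j^*(e^*a)` over a
`Tr_{E/ℚ}(x ȳ)`-orthogonal `ℚ`-basis `ε_j = P_j(η)` of `E` (`u_j = P_j(η) ∈ ℤ[η] ⊂ End A`, `u_0 = 𝟙`, `q_j > 0`), a positive
combination of pull-backs of the hyperplane class (Kähler cone of one model), rational, of type `(1,1)` hence algebraic;
the resolution of the identity `Σ_j q_j P_j(λ) P_j(μ) = [μ = -λ]` makes the derivation `(𝟙 + η)^* - id - η^*` kill `h` on
`H² = H¹ ⌣ H¹`, and `tr(η^* | H¹) = 0` turns that into the Rosati clause. COUNT ONCE: that theorem is the Literature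
seat's; this file only USES it, exactly as XXXI-B used `exists_hasWeilDiscriminantCM` and XXIX used
`VanGeemen1994.exists_projectiveEmbedding_hasWeilDiscriminantNondeg`.

CONTENTS (namespace `Ring2.Hypotheses`; every proof is one term over parts VII-D / XV / XXXI-B):
* §1 `rosatiKaehlerClassSupplyCM_holds : RosatiKaehlerClassSupplyCM` — node 31a / N70 DISCHARGED.
* §2 `polarizedWeilDiscriminantCMExists_holds : PolarizedWeilDiscriminantCMExists` — node 31 (part VII-C's typed supply
  statement) DISCHARGED; `node31_closed` (31a ∧ 31b ∧ 31); `exists_polarizationClass_rosati_discriminantCM` (pointwise form: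
  every Weil-type CM datum sits on SOME component `(E, 2k, δ)` with a genuine polarization class — hard Lefschetz included).
* §3 the consumers of the node-31 binder, BINDER-FREE (primed names; the originals keep their binder as settled edges):
  `weilClassesWeilTypeCM_of_byComponentCM'`, `weilClassesWeilTypeCM_iff_byComponentCM'` (W3-CM exactness on Deligne's
  carriers, UNCONDITIONAL), `weilClassesCMField_of_byComponentCM'`, `weilClassesCMField_iff_byComponentCM'` (exactness
  against the LADDER rung R3, UNCONDITIONAL), `HC_WeilClassesCMField_of_HC_CM_of_componentsCM'` (row W1-CM-Σ),
  `weilClassesCMField_of_divisorGeneratedCMPointed_componentsCM'` (W1′-CM-Σ), `weilClassesCMField_of_anchored_componentsCM'`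
  (anchored-Σ), `HC_CM_iff_weilRungs_of_andre_of_componentsCM'` (granted André 1992 and the transport leaves only).
* §4 `weilComponentsCM_supply_ledger` — audit conjunction: the CM-field δ-component axis has NO polarization-supply binder
  left; every remaining binder of its rows is a TRANSPORT leaf (`hP`, `hV`) or André's theorem.

Consequences for the cell's census (LEAD): N70 ↦ cl(∅) (chain `rosatiKaehlerClassSupplyCM_holds` ←
`Deligne1982.exists_rosatiCompatible_kaehlerClass`), node 31 ↦ cl(∅); part XXXI's invariant-locus rows (§4 there, XXXI-B §3)
and the referee's F69 caveat (non-emptiness of that locus not exhibited) are superseded as far as NODE COST goes — 31a now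
holds on every datum — and stay as explicit-witness rows.

## References

* [vanGeemen1994HodgeAV] B. van Geemen, An introduction to the Hodge conjecture for abelian varieties, LNM 1594 (1994),
  Lemma 5.2 (1)–(3) and its proof.
* [Deligne1982HodgeCycles] P. Deligne (notes by J. S. Milne), Hodge cycles on abelian varieties, LNM 900 (1982), §4:
  p. 30 (1), Lemma 4.6, Sublemma 4.7, p. 47, Thm. 4.8 (a); §5; Milne's endnote 16 (2003 re-edition).
* [MoonenZarhin1998WeilClasses] B. Moonen, Yu. Zarhin, Weil classes on abelian varieties, J. reine angew. Math. 496
  (1998), §1.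
* [Andre1992HodgeCM] Y. André, Une remarque à propos des cycles de Hodge de type CM, Sém. Théorie des Nombres Paris
  1989–90, Progr. Math. 102 (1992), Thm. 0.6.2.
* [CharlesSchnell2014Notes] F. Charles, Ch. Schnell, Notes on absolute Hodge classes, in: Hodge Theory (MN-49, 2014),
  Conj. 11.3.1.
* [Markman2025SurveySecant] E. Markman, survey (arXiv:2509.23403), §12.
-/

noncomputable section

open CategoryTheory
open Literature.AlgebraicTopology.SingularHomology
open Literature.AlgebraicGeometry Literature.AlgebraicGeometry.Motives
open Literature.AlgebraicGeometry.HodgeTheory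
open Literature.AlgebraicGeometry.Deligne1982
open Summit.HodgeConjecture.HodgeConjecture.WeilTypeLadder
open Summit.HodgeConjecture.HodgeConjecture.Theses
open Summit.HodgeConjecture.HodgeConjecture.Ring2Transport

namespace Summit.HodgeConjecture.HodgeConjecture.Ring2.Hypotheses

/-! ## §1 Node 31a is a theorem -/

/-- **Node 31a `RosatiKaehlerClassSupplyCM` (N70) HOLDS**: every Weil-type CM datum `(A, η; R, e₀, k)` carries a
rational, algebraic class of Kähler type `h` with `Q_h(η^*x, y) = -Q_h(x, η^*y)` — van Geemen's Lemma 5.2 (1)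
averaging argument written for a CM field of any degree and PROVED on the carriers by the Literature layer
(`Deligne1982.exists_rosatiCompatible_kaehlerClass`; `IsKaehlerMultiple` / `RosatiCompatible` unfold to its last two
conjuncts). COUNT ONCE: the theorem is the Literature seat's; this is the one-term discharge of the cell's typed node.
[cite: vanGeemen1994HodgeAV, Lemma 5.2 (1)] [cite: Deligne1982HodgeCycles, §4 p. 47 and Thm. 4.8 (a)] -/
theorem rosatiKaehlerClassSupplyCM_holds : RosatiKaehlerClassSupplyCM :=
  fun _R _ _A _η _e₀ _k hW ↦ exists_rosatiCompatible_kaehlerClass hW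

/-! ## §2 Node 31 is a theorem -/

/-- **Node 31 `PolarizedWeilDiscriminantCMExists` HOLDS** (the typed existence statement of part VII-C: every Weil-type
CM datum carries a polarization class, Rosati-compatible with `η`, with Deligne's `E`-Hermitian discriminant witness of
some class `δ ∈ F_ℝˣ/N(E_ℝˣ)`): 31a (§1) fed to part XXXI-B's `polarizedWeilDiscriminantCMExists_of_supply` (31b =
`Deligne1982.exists_hasWeilDiscriminantCM`, Lemma 4.6 / Sublemma 4.7 on the carriers).
[cite: Deligne1982HodgeCycles, §4 p. 30 (1), Lemma 4.6 and Thm. 4.8 (a)] [cite: vanGeemen1994HodgeAV, Lemma 5.2 (1)–(3)] -/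
theorem polarizedWeilDiscriminantCMExists_holds : PolarizedWeilDiscriminantCMExists :=
  polarizedWeilDiscriminantCMExists_of_supply rosatiKaehlerClassSupplyCM_holds

/-- **NODE-31 LEDGER, closed**: 31a, 31b and 31 all hold outright. [cite: Deligne1982HodgeCycles, §4 p. 30 (1), Lemma 4.6, Thm. 4.8 (a)] -/
theorem node31_closed :
    RosatiKaehlerClassSupplyCM ∧ PolarizedWeilDiscriminantCMExistsR ∧ PolarizedWeilDiscriminantCMExists :=
  ⟨rosatiKaehlerClassSupplyCM_holds, polarizedWeilDiscriminantCMExistsR_holds, polarizedWeilDiscriminantCMExists_holds⟩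

/-- **Every Weil-type CM datum sits on a component `(E, 2k, δ)`** — the pointwise form of node 31 used by the slices:
a polarization class `h` (rational, algebraic, hard Lefschetz), Rosati-compatible with `η`, and its discriminant class `δ`.
[cite: Deligne1982HodgeCycles, §4 p. 30 (1) and Lemma 4.6] -/
theorem exists_polarizationClass_rosati_discriminantCM {A : AbelianVariety ℂ} {η : A ⟶ A} {R : Polynomial ℤ}
    [Fact (Irreducible (realPolyQ R))] {e₀ k : ℕ} (hW : IsWeilTypeCM A η R e₀ k) :
    ∃ (h : complexBetti A.X 2) (δ : cmNormResidueGroup R), IsPolarizationClass A.dim A.X h ∧ RosatiCompatible A η h ∧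
      HasWeilDiscriminantCM A η R e₀ k h δ :=
  polarizedWeilDiscriminantCMExists_holds R A η e₀ k hW

/-! ## §3 The δ-exactness rows, binder-free -/

/-- **W3-CM (←) with NO supply binder**: the CM-field δ-components EXHAUST rung R3⁺ `WeilClassesWeilTypeCM` (part VII-D
`weilClassesWeilTypeCM_of_byComponentCM`, its node-31 binder served by §2). [cite: Deligne1982HodgeCycles, §4 p. 30 (1), Lemma 4.6 and Thm. 4.8 (a)] -/
theorem weilClassesWeilTypeCM_of_byComponentCM' (h : WeilClassesByComponentCM) : WeilClassesWeilTypeCM :=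
  weilClassesWeilTypeCM_of_byComponentCM polarizedWeilDiscriminantCMExists_holds h

/-- **W3-CM EXACTNESS on Deligne's carriers, UNCONDITIONAL**: rung R3⁺ `WeilClassesWeilTypeCM` ⟺ the conjunction of the
CM-field δ-component targets `WeilClassesComponentCM R e₀ k δ` over all `(R, e₀ ≥ 2, k, δ)`.
[cite: Deligne1982HodgeCycles, §4 p. 30 (1), Lemma 4.6 and Thm. 4.8 (a)] -/
theorem weilClassesWeilTypeCM_iff_byComponentCM' : WeilClassesWeilTypeCM ↔ WeilClassesByComponentCM :=
  weilClassesWeilTypeCM_iff_byComponentCM polarizedWeilDiscriminantCMExists_holds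

/-- **All δ-components ⟹ R3 with NO supply binder** (part XV `weilClassesCMField_of_byComponentCM`).
[cite: Deligne1982HodgeCycles, §4 p. 30 (1), Lemma 4.6 and Thm. 4.8 (a)] -/
theorem weilClassesCMField_of_byComponentCM' (h : WeilClassesByComponentCM) : WeilClassesCMField :=
  weilClassesCMField_of_byComponentCM polarizedWeilDiscriminantCMExists_holds h

/-- **W3-CM EXACTNESS against the LADDER rung, UNCONDITIONAL**: R3 `WeilClassesCMField` ⟺ the conjunction of the CM-field
δ-component targets (part XV `weilClassesCMField_iff_byComponentCM`, node-31 binder served by §2).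
[cite: Deligne1982HodgeCycles, §4 p. 30 (1) and Lemma 4.6] [cite: MoonenZarhin1998WeilClasses, §1] -/
theorem weilClassesCMField_iff_byComponentCM' : WeilClassesCMField ↔ WeilClassesByComponentCM :=
  weilClassesCMField_iff_byComponentCM polarizedWeilDiscriminantCMExists_holds

/-- **Row W1-CM-Σ with NO supply binder** — rung R3 from `HC_CM` (an ARGUMENT, never a fact), a CM-pointed
`(E, 2k, δ)`-Weil family through every polarized member of every component, and the δ-restricted Weil-confined
variational Hodge statement of every component (part XV `HC_WeilClassesCMField_of_HC_CM_of_componentsCM`).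
[cite: Deligne1982HodgeCycles, §4 proof of Thm. 4.8 (a)–(c) and §5] [cite: CharlesSchnell2014Notes, Conj. 11.3.1] -/
theorem HC_WeilClassesCMField_of_HC_CM_of_componentsCM' (hCM : Theses.RankFourFaces.CMAbelianHodge)
    (hP : ∀ (R : Polynomial ℤ) [Fact (Irreducible (realPolyQ R))] (e₀ k : ℕ) (δ : cmNormResidueGroup R), 2 ≤ e₀ →
      CMPointedWeilFamiliesComponentCM R e₀ k δ)
    (hV : ∀ (R : Polynomial ℤ) [Fact (Irreducible (realPolyQ R))] (e₀ k : ℕ) (δ : cmNormResidueGroup R), 2 ≤ e₀ →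
      WeilVariationalHodgeComponentCM R e₀ k δ) :
    WeilClassesCMField :=
  HC_WeilClassesCMField_of_HC_CM_of_componentsCM hCM polarizedWeilDiscriminantCMExists_holds hP hV

/-- **Row W1′-CM-Σ with NO supply binder** — rung R3 WITHOUT `HC_CM`, from δ-families pointed at a divisor-generated CM
fibre and the δ-VHC of every component (part XV `weilClassesCMField_of_divisorGeneratedCMPointed_componentsCM`).
[cite: Deligne1982HodgeCycles, §5] [cite: CharlesSchnell2014Notes, Conj. 11.3.1] -/
theorem weilClassesCMField_of_divisorGeneratedCMPointed_componentsCM'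
    (hP : ∀ (R : Polynomial ℤ) [Fact (Irreducible (realPolyQ R))] (e₀ k : ℕ) (δ : cmNormResidueGroup R), 2 ≤ e₀ →
      DivisorGeneratedCMPointedWeilFamiliesComponentCM R e₀ k δ)
    (hV : ∀ (R : Polynomial ℤ) [Fact (Irreducible (realPolyQ R))] (e₀ k : ℕ) (δ : cmNormResidueGroup R), 2 ≤ e₀ →
      WeilVariationalHodgeComponentCM R e₀ k δ) :
    WeilClassesCMField :=
  weilClassesCMField_of_divisorGeneratedCMPointed_componentsCM polarizedWeilDiscriminantCMExists_holds hP hV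

/-- **Anchored-Σ with NO supply binder** — rung R3 from the ANCHORED δ-leaves and the δ-VHC of every component (part XV
`weilClassesCMField_of_anchored_componentsCM`). [cite: CharlesSchnell2014Notes, Conj. 11.3.1] [cite: Markman2025SurveySecant, §12] -/
theorem weilClassesCMField_of_anchored_componentsCM'
    (hP : ∀ (R : Polynomial ℤ) [Fact (Irreducible (realPolyQ R))] (e₀ k : ℕ) (δ : cmNormResidueGroup R), 2 ≤ e₀ →
      AnchoredWeilFamiliesComponentCM R e₀ k δ)
    (hV : ∀ (R : Polynomial ℤ) [Fact (Irreducible (realPolyQ R))] (e₀ k : ℕ) (δ : cmNormResidueGroup R), 2 ≤ e₀ →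
      WeilVariationalHodgeComponentCM R e₀ k δ) :
    WeilClassesCMField :=
  weilClassesCMField_of_anchored_componentsCM polarizedWeilDiscriminantCMExists_holds hP hV

/-- **`HC_CM ⟺ R∞ ∧ R3` from the δ-refined CM-field leaves, granted André's theorem — NO supply binder** (part XV
`HC_CM_iff_weilRungs_of_andre_of_componentsCM`; `HC_CM` occurs on both sides as the STATEMENT being priced, never as a
hypothesis of a class target). [cite: Andre1992HodgeCM, Thm. 0.6.2] [cite: Deligne1982HodgeCycles, §4 proof of Thm. 4.8, p. 30 (1) and §5] -/
theorem HC_CM_iff_weilRungs_of_andre_of_componentsCM'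
    (hA : Andre1992_hodgeClasses_cmAbelianVariety_mem_span_pullback_weilClasses)
    (hP₂ : CMPointedWeilFamiliesQuadratic) (hV₂ : WeilVariationalHodgeQuadratic)
    (hP : ∀ (R : Polynomial ℤ) [Fact (Irreducible (realPolyQ R))] (e₀ k : ℕ) (δ : cmNormResidueGroup R), 2 ≤ e₀ →
      CMPointedWeilFamiliesComponentCM R e₀ k δ)
    (hV : ∀ (R : Polynomial ℤ) [Fact (Irreducible (realPolyQ R))] (e₀ k : ℕ) (δ : cmNormResidueGroup R), 2 ≤ e₀ →
      WeilVariationalHodgeComponentCM R e₀ k δ) :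
    Theses.RankFourFaces.CMAbelianHodge ↔ WeilClassesImaginaryQuadratic ∧ WeilClassesCMField :=
  HC_CM_iff_weilRungs_of_andre_of_componentsCM hA hP₂ hV₂ polarizedWeilDiscriminantCMExists_holds hP hV

/-! ## §4 Audit: the Weil-components-CM supply column is empty -/

/-- **SUPPLY-COLUMN LEDGER of the CM-field δ-component axis**: the three typed supply statements hold and both exactness
equivalences are unconditional — every remaining binder of rows W1-CM-Σ / W1′-CM-Σ / anchored-Σ is a TRANSPORT leaf
(`hP`, `hV`) or André's theorem, none is a polarization-supply statement. [cite: Deligne1982HodgeCycles, §4 p. 30 (1), Lemma 4.6, Thm. 4.8 (a)] -/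
theorem weilComponentsCM_supply_ledger :
    (RosatiKaehlerClassSupplyCM ∧ PolarizedWeilDiscriminantCMExistsR ∧ PolarizedWeilDiscriminantCMExists) ∧
      (WeilClassesWeilTypeCM ↔ WeilClassesByComponentCM) ∧ (WeilClassesCMField ↔ WeilClassesByComponentCM) :=
  ⟨node31_closed, weilClassesWeilTypeCM_iff_byComponentCM', weilClassesCMField_iff_byComponentCM'⟩

end Summit.HodgeConjecture.HodgeConjecture.Ring2.Hypotheses

end
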